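import Literature.Analysis.FluidPDE.WeakSolutionMomentumTorus
import HarnessLib

/-!
# Tools for `NoThinMirrorClimateTG` (route `ErgodicMirrorGate`, item stmt-AnomalousDissipation-27270)

Generic lemmas for the proof that, at the pinned Taylor–Green force, no inviscid (`ν = 0`) measure-preserving
weak-Euler climate of the mirror class `Fix K` with finite mean energy is THIN at the skeleton
(`Summit.AnomalousDissipation.AnomalousDissipation.Theorems.ErgodicMirrorGateNoThinMirrorClimateTG.noThinMirrorClimateTG`,
in the companion module `…Theorems.ErgodicMirrorGateNoThinMirrorClimateTG`):

* §1 a COBOUNDARY LEMMA: `∫ (a ∘ S − a) dP = 0` for a measure-preserving `S` of a finite measure space, a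
  measurable real `a` and an integrable difference `a ∘ S − a` (no integrability of `a` itself: clamp `a` to
  `[-n, n]` and let `n → ∞` by dominated convergence, clamping being `1`-Lipschitz);
* §2 TIME SLICES of space–time weak solutions `Torus.IsWeakNSSolutionForcedOn` (Temam 1984, Ch. III §1): a.e.
  `L²` slices (Tonelli), measurability and integrability on `(0,T)` of the pairings `s ↦ (u(s), a)` with a
  continuous field and of the slice inertial pairing `s ↦ ∫ ⟪u(s), (u(s)·∇)Ψ⟫` with a smooth field;
* §3 the WINDOW IDENTITY: for a path `u` solving the weak formulation with `ν = 0` and a constant force `F` on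
  `[0,2)` from `u(0)` whose unit time shift `u(·+1)` solves it from `u(1)`, and every smooth solenoidal `Ψ`,
  `(u(1), Ψ) − (u(0), Ψ) = ∫₀¹ ∫ ⟪u(s), (u(s)·∇)Ψ⟫ ds + (F, Ψ)` (the weak formulation tested with `θ(t)Ψ(x)` for
  a time cut-off `θ` and with its shift, Temam 1984, Ch. III (1.22)–(1.24); FMRT 2001, Ch. IV §1).

References: R. Temam, *Navier–Stokes Equations* (3rd ed., North-Holland 1984), Ch. III §1 [Temam1984];
C. Foias, O. Manley, R. Rosa, R. Temam, *Navier–Stokes Equations and Turbulence* (CUP 2001), Ch. IV §1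
[FMRTTurbulence2001].
-/

-- every `Summit.AnomalousDissipation.AnomalousDissipation.…` name repeats the summit = problem segment (tree layout)
set_option linter.dupNamespace false

noncomputable section

namespace Summit.AnomalousDissipation.AnomalousDissipation.Theorems.ErgodicMirrorGateNoThinMirrorClimateTG

open MeasureTheory Filter Topology Set Function
open scoped ENNReal InnerProductSpace NNReal RealInnerProductSpace ContDiff
open Literature.Analysis.FunctionSpaces Literature.Analysis.FluidPDE
/-! ### §1 The coboundary lemma -/

/-- **Coboundary lemma.** For a measure-preserving self-map `S` of a finite measure space, a measurable real
function `a` and an integrable difference `a ∘ S − a`: `∫ (a ∘ S − a) = 0`. (Clamp `a` to `[-n, n]`: the clamped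
differences have integral zero, are dominated by `|a ∘ S − a|` since clamping is `1`-Lipschitz, and converge
pointwise.) [folklore] -/
theorem integral_comp_sub_eq_zero {Ω : Type*} [MeasurableSpace Ω] {P : Measure Ω} [IsFiniteMeasure P]
    {S : Ω → Ω} (hS : MeasurePreserving S P P) {a : Ω → ℝ} (ha : Measurable a)
    (hD : Integrable (fun z => a (S z) - a z) P) : ∫ z, (a (S z) - a z) ∂P = 0 := by
  set c : ℕ → ℝ → ℝ := fun n x => max (-(n : ℝ)) (min x n) with hc
  have hcm : ∀ n, Measurable (c n) := fun n => measurable_const.max (measurable_id.min measurable_const)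
  have hcb : ∀ (n : ℕ) (x : ℝ), |c n x| ≤ n := fun n x =>
    abs_le.2 ⟨le_max_left _ _, max_le (by linarith [(Nat.cast_nonneg n : (0 : ℝ) ≤ n)]) (min_le_right _ _)⟩
  have hcl : ∀ (n : ℕ) (x y : ℝ), |c n x - c n y| ≤ |x - y| := fun n x y => by
    calc |c n x - c n y| ≤ max |-(n : ℝ) - -(n : ℝ)| |min x n - min y n| :=
          abs_max_sub_max_le_max _ _ _ _
      _ ≤ |x - y| := by
          rw [sub_self, abs_zero]
          refine max_le (abs_nonneg _) ?_
          calc |min x (n : ℝ) - min y n| ≤ max |x - y| |(n : ℝ) - n| := abs_min_sub_min_le_max _ _ _ _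
            _ = |x - y| := by rw [sub_self, abs_zero, max_eq_left (abs_nonneg _)]
  have hcid : ∀ (n : ℕ) (x : ℝ), |x| ≤ n → c n x = x := fun n x hx => by
    obtain ⟨h1, h2⟩ := abs_le.1 hx
    simp only [hc, min_eq_left h2, max_eq_right h1]
  have hint : ∀ n, Integrable (fun z => c n (a z)) P := fun n =>
    ⟨((hcm n).comp ha).aestronglyMeasurable,
      HasFiniteIntegral.of_bounded (C := (n : ℝ)) (ae_of_all _ fun z => by
        rw [Real.norm_eq_abs]; exact hcb n (a z))⟩
  have hintS : ∀ n, Integrable (fun z => c n (a (S z))) P := fun n =>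
    (hS.integrable_comp (hint n).aestronglyMeasurable).2 (hint n)
  have heq : ∀ n, ∫ z, c n (a (S z)) ∂P = ∫ z, c n (a z) ∂P := fun n => by
    have h := integral_map hS.measurable.aemeasurable (f := fun x => c n (a x))
      (by rw [hS.map_eq]; exact (hint n).aestronglyMeasurable)
    rw [hS.map_eq] at h
    exact h.symm
  have h0 : ∀ n, ∫ z, (c n (a (S z)) - c n (a z)) ∂P = 0 := fun n => by
    rw [integral_sub (hintS n) (hint n), heq n, sub_self]
  have hlim : Tendsto (fun n : ℕ => ∫ z, (c n (a (S z)) - c n (a z)) ∂P) atTop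
      (𝓝 (∫ z, (a (S z) - a z) ∂P)) := by
    refine tendsto_integral_of_dominated_convergence (fun z => |a (S z) - a z|)
      (fun n => ((hintS n).sub (hint n)).aestronglyMeasurable) hD.abs
      (fun n => ae_of_all _ fun z => by rw [Real.norm_eq_abs]; exact hcl n _ _)
      (ae_of_all _ fun z => ?_)
    obtain ⟨N, hN⟩ := exists_nat_ge (max |a (S z)| |a z|)
    refine (tendsto_const_nhds (x := a (S z) - a z)).congr' (eventually_atTop.2 ⟨N, fun n hn => ?_⟩)
    have hn' : (N : ℝ) ≤ n := Nat.cast_le.2 hn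
    show a (S z) - a z = c n (a (S z)) - c n (a z)
    rw [hcid n _ ((le_max_left _ _).trans (hN.trans hn')), hcid n _ ((le_max_right _ _).trans (hN.trans hn'))]
  simp_rw [h0] at hlim
  exact (tendsto_nhds_unique hlim tendsto_const_nhds)

/-! ### §2 Time slices of space–time weak solutions -/

section Slices

variable {d : Type*} [Fintype d] [DecidableEq d] {T ν : ℝ} {f u : ℝ → UnitAddTorus d → EuclideanSpace ℝ d}
  {u₀ : UnitAddTorus d → EuclideanSpace ℝ d}

/-- A space–time weak solution is jointly a.e.-strongly measurable for the product of Lebesgue measure on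
`(0,T)` with the torus volume. [folklore] -/
theorem aestronglyMeasurable_uncurry (hu : Torus.IsWeakNSSolutionForcedOn T ν f u₀ u) :
    AEStronglyMeasurable (uncurry u) ((volume.restrict (Ioo 0 T)).prod volume) := by
  have h := Torus.aestronglyMeasurable_uncurry_of_stLift_restrict hu.1
  rwa [Measure.volume_eq_prod, ← Measure.prod_restrict, Measure.restrict_univ] at h

/-- Almost every time slice of a space–time weak solution is square integrable (Tonelli). [folklore] -/
theorem ae_memLp_two (hu : Torus.IsWeakNSSolutionForcedOn T ν f u₀ u) :
    ∀ᵐ s ∂(volume.restrict (Ioo 0 T)), MemLp (u s) 2 volume := by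
  have huS := aestronglyMeasurable_uncurry hu
  have h1 : ∀ᵐ s ∂(volume.restrict (Ioo 0 T)), AEStronglyMeasurable (u s) volume := huS.prodMk_left
  have h2 : ∀ᵐ s ∂(volume.restrict (Ioo 0 T)), ∫⁻ x, ‖u s x‖ₑ ^ 2 < ⊤ :=
    ae_lt_top' (huS.enorm.pow_const 2).lintegral_prod_right' hu.2.1.ne
  filter_upwards [h1, h2] with s hs1 hs2
  refine (memLp_two_iff_integrable_sq_norm hs1).2 ⟨(continuous_pow 2).comp_aestronglyMeasurable hs1.norm, ?_⟩
  show ∫⁻ x, ‖‖u s x‖ ^ 2‖ₑ < ⊤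
  refine lt_of_eq_of_lt (lintegral_congr fun x => ?_) hs2
  rw [Real.enorm_eq_ofReal (sq_nonneg _), ENNReal.ofReal_pow (norm_nonneg _), ofReal_norm]

/-- The energy `s ↦ ∫ ‖u(s)‖²` of a space–time weak solution is integrable on `(0,T)`. [folklore] -/
theorem integrable_integral_norm_sq (hu : Torus.IsWeakNSSolutionForcedOn T ν f u₀ u) :
    Integrable (fun s => ∫ x, ‖u s x‖ ^ 2) (volume.restrict (Ioo 0 T)) := by
  have huS := aestronglyMeasurable_uncurry hu
  have hm : AEMeasurable (fun s => ∫⁻ x, ‖u s x‖ₑ ^ 2) (volume.restrict (Ioo 0 T)) :=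
    (huS.enorm.pow_const 2).lintegral_prod_right'
  refine (integrable_toReal_of_lintegral_ne_top hm hu.2.1.ne).congr ?_
  filter_upwards [ae_memLp_two hu] with s hs
  rw [Torus.lintegral_enorm_sq_eq_ofReal hs, ENNReal.toReal_ofReal (integral_nonneg fun _ => sq_nonneg _)]

/-- The pairing `s ↦ (u(s), a)` of a space–time weak solution with a continuous field is a.e.-strongly
measurable on `(0,T)`. [folklore] -/
theorem aestronglyMeasurable_integral_inner (hu : Torus.IsWeakNSSolutionForcedOn T ν f u₀ u)
    {a : UnitAddTorus d → EuclideanSpace ℝ d} (ha : Continuous a) :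
    AEStronglyMeasurable (fun s => ∫ x, ⟪u s x, a x⟫) (volume.restrict (Ioo 0 T)) := by
  have h1 : AEStronglyMeasurable (fun p : ℝ × UnitAddTorus d => ⟪uncurry u p, a p.2⟫)
      ((volume.restrict (Ioo 0 T)).prod volume) :=
    (aestronglyMeasurable_uncurry hu).inner (ha.comp continuous_snd).aestronglyMeasurable
  exact h1.integral_prod_right'

/-- The pairing `s ↦ (u(s), a)` of a space–time weak solution with a continuous field is integrable on `(0,T)`
(bounded a.e. by `‖a‖_∞ ½ (1 + ∫ ‖u(s)‖²)`). [folklore] -/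
theorem integrable_integral_inner (hu : Torus.IsWeakNSSolutionForcedOn T ν f u₀ u)
    {a : UnitAddTorus d → EuclideanSpace ℝ d} (ha : Continuous a) :
    Integrable (fun s => ∫ x, ⟪u s x, a x⟫) (volume.restrict (Ioo 0 T)) := by
  obtain ⟨K, hK0, hK⟩ := Torus.exists_nonneg_forall_norm_le_of_continuous ha
  refine Integrable.mono' ((((integrable_const (1 : ℝ)).add (integrable_integral_norm_sq hu)).const_mul
    (K * 2⁻¹))) (aestronglyMeasurable_integral_inner hu ha) ?_
  filter_upwards [ae_memLp_two hu] with s hs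
  rw [Real.norm_eq_abs]
  refine (Torus.abs_integral_inner_le_of_norm_le (hs.integrable one_le_two) hK).trans ?_
  refine (mul_le_mul_of_nonneg_left (Torus.integral_norm_le_of_memLp_two hs) hK0).trans_eq ?_
  simp only [Pi.add_apply]
  ring

/-- The slice inertial pairing `s ↦ ∫ ⟪u(s), (u(s)·∇)Ψ⟫` of a space–time weak solution against a smooth field is
a.e.-strongly measurable on `(0,T)`. [folklore] -/
theorem aestronglyMeasurable_inner_convect (hu : Torus.IsWeakNSSolutionForcedOn T ν f u₀ u)
    {Ψ : UnitAddTorus d → EuclideanSpace ℝ d} (hΨ : Torus.IsSmooth Ψ) :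
    AEStronglyMeasurable (fun s => ∫ x, ⟪u s x, Torus.convect (u s) Ψ x⟫) (volume.restrict (Ioo 0 T)) := by
  have hu' := aestronglyMeasurable_uncurry hu
  have hconv : (fun p : ℝ × UnitAddTorus d => Torus.convect (u p.1) Ψ p.2) =
      fun p => ∑ i, (uncurry u p) i • Torus.partialDeriv i Ψ p.2 := by
    funext p
    exact Torus.fderiv_apply_eq_sum_partialDeriv (hΨ.isContDiff (by simp)) _ _
  have hconvm : AEStronglyMeasurable (fun p : ℝ × UnitAddTorus d => Torus.convect (u p.1) Ψ p.2)
      ((volume.restrict (Ioo 0 T)).prod volume) := by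
    rw [hconv]
    exact Finset.aestronglyMeasurable_fun_sum _ fun i _ =>
      ((EuclideanSpace.proj (𝕜 := ℝ) i).continuous.comp_aestronglyMeasurable hu').smul
        ((hΨ.partialDeriv i).continuous.comp continuous_snd).aestronglyMeasurable
  exact (hu'.inner (𝕜 := ℝ) hconvm).integral_prod_right'

/-- The slice inertial pairing `s ↦ ∫ ⟪u(s), (u(s)·∇)Ψ⟫` of a space–time weak solution against a smooth field is
integrable on `(0,T)` (bounded a.e. by `‖∇Ψ‖_∞ ∫ ‖u(s)‖²`). [folklore] -/
theorem integrable_inner_convect (hu : Torus.IsWeakNSSolutionForcedOn T ν f u₀ u)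
    {Ψ : UnitAddTorus d → EuclideanSpace ℝ d} (hΨ : Torus.IsSmooth Ψ) :
    Integrable (fun s => ∫ x, ⟪u s x, Torus.convect (u s) Ψ x⟫) (volume.restrict (Ioo 0 T)) := by
  obtain ⟨C, -, hC⟩ := Torus.exists_sum_norm_partialDeriv_le hΨ
  refine Integrable.mono' ((integrable_integral_norm_sq hu).const_mul C)
    (aestronglyMeasurable_inner_convect hu hΨ) ?_
  filter_upwards [ae_memLp_two hu] with s hs
  rw [Real.norm_eq_abs]
  exact Torus.abs_integral_inner_convect_self_le hs hΨ hC

end Slices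

/-! ### §3 The window identity -/

section Window

variable {d : Type*} [Fintype d] [DecidableEq d]

/-- **Window identity.** If a path `u` solves the weak Navier–Stokes formulation with `ν = 0` and a constant force
`F` on `[0,2)` from the datum `u(0)`, and its unit time shift `u1 = u(·+1)` solves it from the datum `u1(0) = u(1)`,
then for every smooth solenoidal `Ψ`: `(u(1), Ψ) − (u(0), Ψ) = ∫₀¹ ∫ ⟪u(s), (u(s)·∇)Ψ⟫ ds + (F, Ψ)`.
(Test both formulations with `θΨ`, `θ` a time cut-off equal to `1` near `0` and vanishing after `1/2`, resp. with
its shift `θ(·−1)Ψ`, and subtract: the shifted integrand on `(1,2)` cancels, the cut-off is `1` on `(0,1)`;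
Temam 1984, Ch. III (1.22)–(1.24).) [cite: Temam1984, Ch. III §1.1 (1.22)–(1.24)] -/
theorem window_identity {F : UnitAddTorus d → EuclideanSpace ℝ d} (hFi : Integrable F volume)
    {Ψ : UnitAddTorus d → EuclideanSpace ℝ d} (hΨ : Torus.IsSmooth Ψ) (hΨd : Torus.IsDivFree Ψ)
    {u u1 : ℝ → UnitAddTorus d → EuclideanSpace ℝ d} (hu1 : ∀ t, u1 t = u (t + 1))
    (h0 : Torus.IsWeakNSSolutionForcedOn 2 0 (fun _ => F) (u 0) u)
    (h1 : Torus.IsWeakNSSolutionForcedOn 2 0 (fun _ => F) (u1 0) u1) :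
    (∫ x, ⟪u1 0 x, Ψ x⟫) - ∫ x, ⟪u 0 x, Ψ x⟫ =
      (∫ s in Ioo (0 : ℝ) 1, ∫ x, ⟪u s x, Torus.convect (u s) Ψ x⟫) + ∫ x, ⟪F x, Ψ x⟫ := by
  -- the time cut-off `θ` (`= 1` on `[-1, 1/4]`, `= 0` on `[1/2, ∞)`) and its unit shift `φ`
  set θ : ContDiffBump (-(3 / 8 : ℝ)) := ⟨5 / 8, 7 / 8, by norm_num, by norm_num⟩ with hθdef
  have hθ1 : ∀ t : ℝ, -1 ≤ t → t ≤ 1 / 4 → θ t = 1 := fun t h1 h2 =>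
    θ.one_of_mem_closedBall (by
      rw [Metric.mem_closedBall, Real.dist_eq]
      show |t - -(3 / 8)| ≤ 5 / 8
      exact abs_le.2 ⟨by linarith, by linarith⟩)
  have hθ0 : ∀ t : ℝ, 1 / 2 ≤ t → θ t = 0 := fun t ht =>
    θ.zero_of_le_dist (by
      rw [Real.dist_eq]
      show (7 : ℝ) / 8 ≤ |t - -(3 / 8)|
      rw [abs_of_nonneg (by linarith)]
      linarith)
  have hθT : tsupport (θ : ℝ → ℝ) ⊆ Iio 2 := by
    rw [θ.tsupport_eq]
    intro t ht
    rw [Metric.mem_closedBall, Real.dist_eq] at ht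
    change |t - -(3 / 8)| ≤ 7 / 8 at ht
    rw [mem_Iio]
    linarith [(abs_le.1 ht).2]
  have hderivθ0 : ∀ s : ℝ, 1 / 2 < s → deriv θ s = 0 := fun s hs => by
    have h : (θ : ℝ → ℝ) =ᶠ[𝓝 s] fun _ => 0 :=
      eventually_of_mem (Ioi_mem_nhds hs) fun t ht => hθ0 t (le_of_lt ht)
    rw [h.deriv_eq, deriv_const]
  set φ : ℝ → ℝ := fun t => θ (t - 1) with hφdef
  have hφ : ContDiff ℝ ∞ φ := θ.contDiff.comp (contDiff_id.sub contDiff_const)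
  have hφ0 : ∀ t : ℝ, t ∉ Icc (-1 / 2 : ℝ) (3 / 2) → φ t = 0 := fun t ht => by
    rw [mem_Icc, not_and_or, not_le, not_le] at ht
    refine θ.zero_of_le_dist ?_
    rw [Real.dist_eq]
    show (7 : ℝ) / 8 ≤ |t - 1 - -(3 / 8)|
    rcases ht with ht | ht
    · rw [abs_of_neg (by linarith)]
      linarith
    · rw [abs_of_pos (by linarith)]
      linarith
  have hφc : HasCompactSupport φ := HasCompactSupport.intro isCompact_Icc hφ0
  have hφT : tsupport φ ⊆ Iio 2 :=
    (closure_minimal (support_subset_iff'.2 hφ0) isClosed_Icc).trans fun t ht => by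
      rw [mem_Iio]; linarith [ht.2]
  have hφ1 : ∀ t : ℝ, 0 ≤ t → t ≤ 5 / 4 → φ t = 1 := fun t h1 h2 => hθ1 (t - 1) (by linarith) (by linarith)
  have hderivφ : ∀ t, deriv φ t = deriv θ (t - 1) := fun t =>
    deriv_comp_sub_const (f := (θ : ℝ → ℝ)) (a := (1 : ℝ)) (x := t)
  have hderivφ0 : ∀ s ∈ Ioo (0 : ℝ) 1, deriv φ s = 0 := fun s hs => by
    have h : φ =ᶠ[𝓝 s] fun _ => 1 :=
      eventually_of_mem (Ioo_mem_nhds hs.1 (by linarith [hs.2] : s < 5 / 4)) fun t ht =>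
        hφ1 t ht.1.le ht.2.le
    rw [h.deriv_eq, deriv_const]
  have hφb : ∀ t, ‖φ t‖ ≤ 1 := fun t => by
    rw [Real.norm_eq_abs]
    exact abs_le.2 ⟨by linarith [θ.nonneg (x := t - 1)], θ.le_one⟩
  obtain ⟨Cφ, hCφ⟩ := (hφ.continuous_deriv (by simp)).bounded_above_of_compact_support hφc.deriv
  -- the two tested weak formulations
  have hB := h0.test_smul_ae (ae_memLp_two h0) (ae_of_all _ fun _ => hFi) hΨ hΨd hφ hφc hφT
  have hA := h1.test_smul_ae (ae_memLp_two h1) (ae_of_all _ fun _ => hFi) hΨ hΨd θ.contDiff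
    θ.hasCompactSupport hθT
  rw [hθ1 0 (by norm_num) (by norm_num), one_mul] at hA
  rw [hφ1 0 le_rfl (by norm_num), one_mul] at hB
  -- the flux at `L²` slices
  have hΦae : ∀ᵐ s ∂(volume.restrict (Ioo (0 : ℝ) 2)),
      (∫ x, (⟪u s x, Torus.convect (u s) Ψ x⟫ + 0 * ⟪u s x, Torus.laplacian Ψ x⟫ + ⟪F x, Ψ x⟫)) =
        (∫ x, ⟪u s x, Torus.convect (u s) Ψ x⟫) + ∫ x, ⟪F x, Ψ x⟫ := by
    filter_upwards [ae_memLp_two h0] with s hs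
    simp only [zero_mul, add_zero]
    exact integral_add (Torus.integrable_inner_convect_self hs hΨ)
      (Torus.integrable_inner_of_continuous hFi hΨ.continuous)
  -- integrability of the `(B)` integrand on `(0,2)`
  have hαi := integrable_integral_inner h0 hΨ.continuous
  have hΦi : Integrable (fun s => ∫ x, (⟪u s x, Torus.convect (u s) Ψ x⟫ +
      0 * ⟪u s x, Torus.laplacian Ψ x⟫ + ⟪F x, Ψ x⟫)) (volume.restrict (Ioo (0 : ℝ) 2)) :=
    ((integrable_inner_convect h0 hΨ).add (integrable_const _)).congr
      (by filter_upwards [hΦae] with s hs; exact hs.symm)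
  have hBi : Integrable (fun s => deriv φ s * (∫ x, ⟪u s x, Ψ x⟫) + φ s * ∫ x,
      (⟪u s x, Torus.convect (u s) Ψ x⟫ + 0 * ⟪u s x, Torus.laplacian Ψ x⟫ + ⟪F x, Ψ x⟫))
      (volume.restrict (Ioo (0 : ℝ) 2)) :=
    (hαi.bdd_mul (hφ.continuous_deriv (by simp)).aestronglyMeasurable (ae_of_all _ hCφ)).add
      (hΦi.bdd_mul hφ.continuous.aestronglyMeasurable (ae_of_all _ hφb))
  -- (i) the `(A)` integrand vanishes on `[1, 2)` and, shifted by one, is the `(B)` integrand on `(1, 2)`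
  have hLBA : ∀ t : ℝ, deriv φ t * (∫ x, ⟪u t x, Ψ x⟫) + φ t * (∫ x,
      (⟪u t x, Torus.convect (u t) Ψ x⟫ + 0 * ⟪u t x, Torus.laplacian Ψ x⟫ + ⟪F x, Ψ x⟫)) =
      deriv θ (t - 1) * (∫ x, ⟪u1 (t - 1) x, Ψ x⟫) + θ (t - 1) * (∫ x,
      (⟪u1 (t - 1) x, Torus.convect (u1 (t - 1)) Ψ x⟫ + 0 * ⟪u1 (t - 1) x, Torus.laplacian Ψ x⟫ +
        ⟪F x, Ψ x⟫)) := fun t => by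
    rw [hderivφ, hu1, sub_add_cancel]
  have hA1 : (∫ s in Ioo (0 : ℝ) 2, (deriv θ s * (∫ x, ⟪u1 s x, Ψ x⟫) + θ s * ∫ x,
      (⟪u1 s x, Torus.convect (u1 s) Ψ x⟫ + 0 * ⟪u1 s x, Torus.laplacian Ψ x⟫ + ⟪F x, Ψ x⟫))) =
      ∫ s in Ioo (1 : ℝ) 2, (deriv φ s * (∫ x, ⟪u s x, Ψ x⟫) + φ s * ∫ x,
      (⟪u s x, Torus.convect (u s) Ψ x⟫ + 0 * ⟪u s x, Torus.laplacian Ψ x⟫ + ⟪F x, Ψ x⟫)) := by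
    rw [setIntegral_eq_of_subset_of_forall_sdiff_eq_zero measurableSet_Ioo
      (Ioo_subset_Ioo_right (by norm_num : (1 : ℝ) ≤ 2))]
    · rw [← integral_indicator measurableSet_Ioo, ← integral_indicator measurableSet_Ioo]
      refine ((integral_sub_right_eq_self _ (1 : ℝ)).symm).trans (integral_congr_ae (ae_of_all _ fun t => ?_))
      dsimp only
      by_cases ht : t ∈ Ioo (1 : ℝ) 2
      · have ht' : t - 1 ∈ Ioo (0 : ℝ) 1 := ⟨by linarith [ht.1], by linarith [ht.2]⟩
        rw [indicator_of_mem ht', indicator_of_mem ht, hLBA t]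
      · have ht' : t - 1 ∉ Ioo (0 : ℝ) 1 := fun h => ht ⟨by linarith [h.1], by linarith [h.2]⟩
        rw [indicator_of_notMem ht', indicator_of_notMem ht]
    · intro s hs
      have hs1 : 1 ≤ s := by
        by_contra h
        exact hs.2 ⟨hs.1.1, not_le.mp h⟩
      rw [hθ0 s (by linarith), hderivθ0 s (by linarith), zero_mul, zero_mul, add_zero]
  -- (ii) split the `(B)` integral at `t = 1`
  have hB1 : (∫ s in Ioo (0 : ℝ) 2, (deriv φ s * (∫ x, ⟪u s x, Ψ x⟫) + φ s * ∫ x,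
      (⟪u s x, Torus.convect (u s) Ψ x⟫ + 0 * ⟪u s x, Torus.laplacian Ψ x⟫ + ⟪F x, Ψ x⟫))) =
      (∫ s in Ioo (0 : ℝ) 1, ∫ x,
        (⟪u s x, Torus.convect (u s) Ψ x⟫ + 0 * ⟪u s x, Torus.laplacian Ψ x⟫ + ⟪F x, Ψ x⟫)) +
      ∫ s in Ioo (1 : ℝ) 2, (deriv φ s * (∫ x, ⟪u s x, Ψ x⟫) + φ s * ∫ x,
      (⟪u s x, Torus.convect (u s) Ψ x⟫ + 0 * ⟪u s x, Torus.laplacian Ψ x⟫ + ⟪F x, Ψ x⟫)) := by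
    have hsplit : Ioo (0 : ℝ) 2 = Ioo 0 1 ∪ Ico 1 2 := (Ioo_union_Ico_eq_Ioo zero_lt_one one_le_two).symm
    have hdisj : Disjoint (Ioo (0 : ℝ) 1) (Ico 1 2) := disjoint_left.2 fun x hx hx' => by
      have h1 := hx.2
      have h2 := hx'.1
      linarith
    have hBi' : IntegrableOn (fun s => deriv φ s * (∫ x, ⟪u s x, Ψ x⟫) + φ s * ∫ x,
        (⟪u s x, Torus.convect (u s) Ψ x⟫ + 0 * ⟪u s x, Torus.laplacian Ψ x⟫ + ⟪F x, Ψ x⟫))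
        (Ioo (0 : ℝ) 2) volume := hBi
    have h01 : Ioo (0 : ℝ) 1 ⊆ Ioo 0 2 := Ioo_subset_Ioo_right (by norm_num)
    have h12 : Ico (1 : ℝ) 2 ⊆ Ioo 0 2 := fun x hx => ⟨by linarith [hx.1], hx.2⟩
    rw [hsplit, setIntegral_union hdisj measurableSet_Ico (hBi'.mono_set h01) (hBi'.mono_set h12),
      ← setIntegral_congr_set Ioo_ae_eq_Ico]
    congr 1
    refine setIntegral_congr_fun measurableSet_Ioo fun s hs => ?_
    rw [hderivφ0 s hs, hφ1 s hs.1.le (by linarith [hs.2]), zero_mul, zero_add, one_mul]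
  -- (iii) on `(0,1)` the flux is the inertial pairing plus the pump
  have hΦ01 : (∫ s in Ioo (0 : ℝ) 1, ∫ x,
      (⟪u s x, Torus.convect (u s) Ψ x⟫ + 0 * ⟪u s x, Torus.laplacian Ψ x⟫ + ⟪F x, Ψ x⟫)) =
      (∫ s in Ioo (0 : ℝ) 1, ∫ x, ⟪u s x, Torus.convect (u s) Ψ x⟫) + ∫ x, ⟪F x, Ψ x⟫ := by
    have h01 : Ioo (0 : ℝ) 1 ⊆ Ioo 0 2 := Ioo_subset_Ioo_right (by norm_num)
    rw [integral_congr_ae (ae_restrict_of_ae_restrict_of_subset h01 hΦae),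
      integral_add ((integrable_inner_convect h0 hΨ).mono_measure (Measure.restrict_mono h01 le_rfl))
        (integrable_const _), setIntegral_const, Real.volume_real_Ioo_of_le zero_le_one, sub_zero, one_smul]
  rw [hA1] at hA
  rw [hB1, hΦ01] at hB
  linarith

end Window

end Summit.AnomalousDissipation.AnomalousDissipation.Theorems.ErgodicMirrorGateNoThinMirrorClimateTG

end
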